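import Mathlib
import HarnessLib
import HarnessLib.Audit
import Summits.AtomisticToContinuum.Statement
import Literature.MathematicalPhysics.QuantumManyBody.PeriodicBoseGas
import Literature.MathematicalPhysics.QuantumManyBody.PeriodicBoseGasJastrow

/-!
Route: BECParentHamiltonian

CLOSED (retired) 2026-08-15T13:39:17Z by operator:999:1257524 — reason: not-a-thesis: assembly does not conclude the sub-problem Statement — note: D-0027 §2.1 audit (human 2026-08-15: routes that do not decide the summit are removed): the assembly concludes `Literature.MathematicalPhysics.QuantumManyBody.BoseGas.BoseEinsteinCondensation`, not the sub-problem statement; a NEW conforming route may be opened from the same idea (generated `closes . The file is kept as the record of this route; refuted decls are indexed as negative knowledge (`ledger negatives`).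

# Route BECParentHamiltonian — Jastrow parent-Hamiltonian anchor — condensation reduced to
one-particle flatness of the pair-dressed corrector

X = CorrectorFlatness ∧ DressingBound ∧ BoundaryTransferWeak ("it suffices to show X"; card
parent-hamiltonian-anchor made formal on the TORUS).
ANCHOR (card (A)): for a pair profile φ (IsPairProfile b φ: C¹, even, 0 ≤ φ ≤ 1, φ = 1 off B_b) the
Jastrow state F = Π_{i<j}Φ(x_i−x_j) is the
zero-energy ground state of the parent Hamiltonian H_F = −Δ + ΔF/F, whose quadratic form is the
weighted Dirichlet form ∫F²|∇(Ψ/F)|² (ground-state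
representation; ΔF/F never has to be written). The anchor CONDENSES, elementarily and uniformly in
N: n₀(F)/N ≥ (1 − (N−1)∫(1−φ²)/L³)² (support
JastrowAnchorBEC), hence so do all near-minimisers of the parent form (support ParentHamiltonianBEC)
— a genuinely interacting (2-body well + core +
explicit 3-body) 3-D continuum Hamiltonian with thermodynamic-limit ground-state BEC for dressing
ranges b up to ξ/2 (ξ = healing length).
TRANSFER (card (B), made N-uniform and gap-free): write any periodic N-body Ψ as Ψ(x,Y) =
D_Y(x)·g_Y(x) with the one-particle dressing
D_Y(x) = Π_j Φ(x − y_j). DressingBound (support, deterministic): if the dressed corrector g_Y is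
L²-flat over the cell, L³∫|g_Y|² ≤ (1+K)|∫g_Y|², for a
set of environments Y of |Ψ|²-mass ≥ 1−η, then n₀(Ψ) ≥ (1−η)(1−√(ρJ(1+K)))²/(1+K)·N (J ≥ ∫(1−φ²)).
CorrectorFlatness (crux 2): δ-near-minimisers of the
periodic energy of v at small ρ admit such a profile with these flatness parameters, uniformly in N.
ParentEnergyProximity (crux 3): near-minimisers
are ε-approximate ground states of a Jastrow parent Hamiltonian, ∫F²|∇(Ψ/F)|² ≤ ερN — the
quantitative "anchor ≈ truth" feeding layer 2.
CorrectorFlatness ∧ DressingBound ⇒ PeriodicBEC (target, shared stmt-0826) ⇒ the conjunct via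
BoundaryTransferWeak (crux 4, shared stmt-0827).
Lean: `CorrectorFlatness ∧ DressingBound ∧ BoundaryTransferWeak`

## Assembly
Bookkeeping + composition. Given v admissible: CorrectorFlatness gives ρ₀ and, per ρ, (b, K, η, J,
φ) with ρJ(1+K) < 1 and eventually-in-n the
flat-mass bound ≥ 1−η for all δ-near-minimisers; for n large also 2b < L = ((n+1)/ρ)^{1/3} and
nJ(1+K)/L³ = ρJ(1+K)·n/(n+1) < 1, so DressingBound
applies and yields n₀ ≥ c(n+1) with c := (1−η)(1−√(ρJ(1+K)))²/(1+K) > 0 (monotonicity of t ↦ (1−√t)²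
on [0,1]); shifting N = n+1 in the filter gives
exactly the PeriodicBEC-body for v, which is the hypothesis of BoundaryTransferWeak at v; its
conclusion is the conjunct's body for v.

Rationale: WHY THIS LINE. The AKLT/Laughlin parent-Hamiltonian trick pointed at the dilute gas
(CalogeroMarchioro1973 doi:10.1063/1.1666291; card audit: KKLZ1991, KhareRay1997):
LSSY's own Dyson/Jastrow product (LiebSeiringerSolovejYngvason2005 Thm 2.2, in tree as
PeriodicBoseGasJastrow) is an EXACT ground state of an explicit
interacting Hamiltonian, and its condensation is not a cluster-expansion theorem but a five-line
consequence of LSSY's one-particle elimination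
Π(1−g_j) ≥ 1−Σg_j ((2.24)–(2.25)) and of Mayers' identity n₀/N = E_Y |∫Ψ(·,Y)|²/(L³∫|Ψ(·,Y)|²)
(Mayers2001 doi:10.1103/physrevb.64.224521, physics
level). The same two lines give the deterministic DressingBound, which converts thermodynamic-limit
condensation of the TRUE gas into a one-particle
statement: the corrector g = Ψ/D left after dividing out the pair structure seen by one particle is
flat over the cell for most environments. Imported
areas: classical/probabilistic conditioning (the environment average, Cauchy–Schwarz in one
coordinate), the ground-state (Doob h-) representation of
Schrödinger forms, Jastrow variational theory (ReattoChester1967 phonon tail as the heuristic size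
of Var log g ≈ ρα²/b, finite in d = 3, divergent in
d = 1). Versus the routes on file: BECPeriodicReduction only reformulates; BECJastrowKac (same
splitting identity) files window-condensation CONCLUSIONS
to be reached by Kac–Siegert/CLT, and leaves the reference ODLRO unfiled — here the anchor theorems
are typed supports and the cruxes are the RELATIVE,
state-level statements (flat dressed corrector; parent-energy proximity) that its kill criteria name
as the pivot; BECConditionalEntropy/BECPalmLandscape
bound the entropy/participation of the RAW conditional law p(·|Y) in the Dirichlet box — here the
functional is applied to the DRESSED corrector on the
torus, which divides out the two-body zeros (hard cores included) exactly and ties flatness to the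
parent residual Q = Kac well − W₃. Negatives index:
empty at filing.

RANKED CRUXES. #0 PeriodicBEC (target) — constant-mode BEC for δ-near-minimisers of the periodic
energy on the torus of side (N/ρ)^{1/3}, every repulsive finite-range v, all small ρ (verbatim item
stmt-AtomisticToContinuum-0826 of route BECPeriodicReduction, shared with BECJastrowKac); implied by
CorrectorFlatness ∧ DressingBound by the bookkeeping recorded in § Assembly. (why it might fail: the
textbook open problem (LSSY2005 §1.2, Ch. 5); for this route it fails iff CorrectorFlatness fails
(DressingBound is deterministic).) [LiebSeiringerSolovejYngvason2005, Fournais2020, Junge2026]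
#2 CorrectorFlatness (crux) — for every repulsive finite-range v there is ρ₀ > 0 such that for 0 < ρ
< ρ₀ there are a positive C¹ pair profile φ of cut-off b, K ≥ 0, 0 ≤ η < 1 and J ≥ ∫(1−φ²) with
ρJ(1+K) < 1 such that for all large N = n+1 there is δ > 0 with: every δ-near-minimiser Ψ of the
PERIODIC energy of v on the torus of side L = (N/ρ)^{1/3} has an L²-flat dressed corrector,
L³∫_cell|g_Y|² ≤ (1+K)|∫_cell g_Y|² with g_Y(x) = Ψ(x,Y)/Π_jΦ(x−y_j), for a set of environments Y ∈
cell^n of |Ψ|²-mass ≥ 1−η (card crux (B) in state-level, N-uniform form; complex Ψ allowed: phase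
rigidity at fixed N is part of the claim). [difficulty: open-problem] (why it might fail: Var_x
log|g_Y| is set by the Reatto–Chester tail u≈α/r² beyond b: ≈ρα²/b in 3D (plausible) but
log-divergent in 1D; mass ≥1−η for ALL δ-near-minimisers needs GS uniqueness+gap at fixed N (hard
shells v=⊤·1_[R₁,R₂]); no tool controls g uniformly in N (card audit).) [ReattoChester1967 =
doi:10.1103/physrev.155.88, Griffin1993 §9.1 (9.3) p.183 and p.188 (lit:
book:griffin1993-excitations-bose-condensed-liquid), Mayers2001 = doi:10.1103/physrevb.64.224521,
LiebSeiringerSolovejYngvason2005 Ch. 5,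
Literature.Barriers.AtomisticToContinuum.PitaevskiiStringariOneDimension,
Literature.Barriers.AtomisticToContinuum.OneDimensionalHardCore,
Literature.Barriers.AtomisticToContinuum.KineticGapLengthScales]
#3 ParentEnergyProximity (crux) — for every repulsive finite-range v and every ε > 0 there is ρ₀ > 0
such that for 0 < ρ < ρ₀ some positive C¹ pair profile φ (cut-off b; intended: the
zero-scattering-length Dyson/Neumann function of v at b = Mρ^{-1/3}, smoothed) makes every
δ-near-minimiser Ψ of the periodic energy (N = n+1 large, δ = δ(N) > 0, L = (N/ρ)^{1/3}) an
ε-approximate ground state of the parent Hamiltonian of F = Π_{i<j}Φ(x_i−x_j): ∫_{cell^N}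
F²|∇(Ψ/F)|² ≤ ερN. Route to it: the identity E_v[Fg] = ∫F²|∇g|² + ∫|Fg|²(ε_wΣw − W₃), the proved
upper bound E₀ ≤ 4πaρN(1+o(1)) (LSSY2005_upperBound_periodic_holds), the free positive-definite pair
count ⟨Σ_{i<j}w⟩ ≥ ½N(ρŵ(0) − w(0)), and a three-body bound on ⟨W₃⟩. [difficulty: L] (why it might
fail: needs ⟨W₃⟩_Ψ=⟨Σ_iΣ_{j≠k}∇logφ_ij·∇logφ_ik⟩ ≲ (ρab²)·aρN for near-minimisers — a three-body
(second local-density moment) bound at scale b≫ρ^{-1/3} not in print for TL ground states; cores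
force θ-regularised φ with ∇logφ∼1/θ at contact.) [LiebSeiringerSolovejYngvason2005 Thm 2.2 and
Lemma 2.5, Literature.MathematicalPhysics.QuantumManyBody.BoseGas.LSSY2005_upperBound_periodic,
Literature.MathematicalPhysics.QuantumManyBody.BoseGas.LSSY2005_dysonProfile, CalogeroMarchioro1973
= doi:10.1063/1.1666291, BastiCenatiempoSchlein2021 = doi:10.1017/fms.2021.66, FournaisSolovej2020,
Literature.Barriers.AtomisticToContinuum.KineticGapLengthScales]
#4 BoundaryTransferWeak (crux) — for each repulsive finite-range v, PeriodicBEC-body(v) ⇒ ∃ρ₀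
∀ρ∈(0,ρ₀) HasGroundStateBEC v ρ (Dirichlet, mode-free) — verbatim item
stmt-AtomisticToContinuum-0827 of route BECPeriodicReduction (shared). Not glue: near-minimiser
slacks O(N/L²) vs wall energy ≫ N/L²; expected via Neumann bracketing of interior sub-boxes + λ_max
≥ tr γ²/N. [difficulty: L] (why it might fail: PeriodicBEC(v) is ground-state-only (δ after N); the
Dirichlet GS restricted to interior boxes is neither periodic nor of sharp N, so the hypothesis may
never fire (transfer ≈ conjunct); BEC can be BC-sensitive (Robinson 1976).)
[LiebSeiringerSolovejYngvason2005 Ch. 2 after (2.8), Basti2022 = arXiv:2203.01841,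
BoccatoSeiringer2023 = arXiv:2205.15284, Junge2026 = arXiv:2603.20776, Robinson1976 =
doi:10.1007/bf01608554]
#9 JastrowAnchorBEC (support) — the anchor condenses, deterministically: for every pair profile φ of
cut-off b (0 < 2b < L), every N and I ≥ ∫(1−φ²) with (N−1)I < L³, the normalised Jastrow product
Π_{i<j}Φ(x_i−x_j)/‖·‖ on the torus of side L has constant-mode occupation ≥ (1 − (N−1)I/L³)²·N.
Proof: n₀/N = ∫ L³|m(Y)|²dY with m = cell-mean of Ψ(·,Y); Π_jΦ(x−y_j) ≥ 1 − Σ_j(1−Φ(x−y_j)) (LSSY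
(2.24)–(2.25)) gives cell-mean ≥ 1 − (N−1)I/L³ while the cell-mean-square is ≤ 1. With
LSSY2005_dysonProfile (I ≤ 16πab²): n₀/N ≥ 1/4 for b ≤ ξ/2, ξ = (8πρa)^{-1/2}. [difficulty:
provable-now] [LiebSeiringerSolovejYngvason2005 Thm 2.2 proof (2.22)–(2.26), Mayers2001 =
doi:10.1103/physrevb.64.224521, PenroseOnsager1956 §6, Griffin1993 p.188]
#9 DressingBound (support) — deterministic dressing transfer at fixed N = n+1, L, positive profile φ
(0 < 2b < L), K, J ≥ ∫(1−φ²) with nJ(1+K) < L³: for every periodic trial state Ψ,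
(n+1)(1−√(nJ(1+K)/L³))²/(1+K) × [|Ψ|²-mass of the environments Y ∈ cell^n whose dressed corrector
g_Y = Ψ(·,Y)/Π_jΦ(·−y_j) satisfies L³∫_cell|g_Y|² ≤ (1+K)|∫_cell g_Y|²] ≤ n₀(Ψ). Proof: |∫Dg| ≥ |∫g|
− √(∫(1−D))·√(∫|g|²), ∫_cell(1−D) ≤ nJ, and ∫|Dg|² ≤ ∫|g|²; then n₀ = (n+1)∫L³|m|² ≥ c₀(n+1)∫_flat
L³ s. [difficulty: provable-now] [Mayers2001 = doi:10.1103/physrevb.64.224521,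
LiebSeiringerSolovejYngvason2005 (2.24)–(2.25)]
#9 ParentHamiltonianBEC (support) — the card's theorem-candidate (A) in near-minimiser form: for
every positive pair profile φ (cut-off b), J ≥ ∫(1−φ²) and density with 2ρJ ≤ 1, for all large N =
n+1 there is δ > 0 such that every periodic trial state Ψ whose parent form ∫_{cell^N}F²|∇(Ψ/F)|² is
≤ δ (i.e. every δ-near-minimiser of the parent Hamiltonian H_F = −Δ + ΔF/F ≥ 0, whose ground state
is the Jastrow state F) has constant-mode occupation ≥ N/8 on the torus of side (N/ρ)^{1/3}. Proof:
weighted Poincaré on the torus at fixed N (F² ∈ [θ^{N(N−1)},1]) ⇒ Ψ ≈ cF in L²; √(n₀/N) is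
1-Lipschitz in Ψ; JastrowAnchorBEC. [difficulty: M] [CalogeroMarchioro1973 = doi:10.1063/1.1666291,
LiebSeiringerSolovejYngvason2005 Lemma 4.1 (in tree: LSSY2005_lemma41_periodic,
neumannPoincare_boxN), ReedSimonIV1978 XIII.12]

TWO-LAYER PLAN. Foreseen, not filed. CorrectorFlatness ⇐ RegularEnvironments → RegularFlatness →
CorrectorFlatness: RegularEnvironments = |Ψ|²-most Y are
(b,M)-regular (local counts in b-balls ≤ Mρb³, no core clusters — second-moment bounds of the
ParentEnergyProximity type); RegularFlatness = for
regular Y the dressed corrector of the (unique, positive) ground state is K-flat — the card's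
Markov-generator bet: g is the principal eigenfunction of
−L_F + Q on L²(F²dX) (L_F the F²-reversible dilute diffusion, Q = ε_wΣw − W₃ shallow), attacked by
Feynman–Kac with a tagged-particle influence bound
(integrable t^{-3/2} decorrelation in d = 3). ParentEnergyProximity ⇐ ParentIdentity →
ResidualLowerBound → ParentEnergyProximity: ParentIdentity =
E_v[Fg] = ∫F²|∇g|² + ∫|Fg|²(Σ(v − 2Δφ/φ) − W₃) for C² positive profiles (integration by parts on the
torus); ResidualLowerBound = ε_w⟨Σw⟩ − ⟨W₃⟩ ≥
E₀^per − ερN for near-minimisers (positive-definite pair counting + three-body moment bound). k ≤ 3,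
depth 1 each.

KILL CRITERIA. ¬CorrectorFlatness for some admissible v at arbitrarily small ρ (e.g. a proof that
for every short-range positive dressing the dressed corrector of the
torus ground state has flat-mass → 0, or Var_x log|g| → ∞) closes the route (close --reason
refuted:CorrectorFlatness); since DressingBound is a theorem
this would also show that near-complete constant-mode condensation fails structurally — a discovery
either way. ¬ParentEnergyProximity (the true
near-minimisers are not approximate parent ground states for ANY positive C¹ profile) does not kill
the route but kills the parent-Hamiltonian engine of
layer 2 and BECJastrowKac's dressed window at once ⇒ pivot CorrectorFlatness to non-Jastrow
(three-body-corrected) dressings. ¬BoundaryTransferWeak kills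
the Dirichlet transfer for every torus route (shared fate with BECPeriodicReduction, BECJastrowKac).
PeriodicBEC proved elsewhere moots cruxes 2–3
(close --reason superseded).

NOT DECOMPOSED YET. The parent profile itself (zero-scattering-length Neumann/Dyson function of v −
ε_w w with smooth flat continuation, LSSY Lemma 2.5 objects; for hard
cores a θ-regularised positive version) — a lemma under ParentEnergyProximity (--supports),
deliberately existential in the crux; the N-body parent
identity and the W₃ bound (layer-2 children above); ground-state uniqueness/positivity and the
fixed-N gap on the torus (inside CorrectorFlatness for
complex near-minimisers; the Dirichlet analogue is the shared item GroundStateRigidity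
stmt-AtomisticToContinuum-3298 of BECPalmLandscape /
BECConditionalEntropy — a periodic twin will be filed only if a prover asks); weighted Poincaré at
fixed N (inside ParentHamiltonianBEC); the card's
deformation family H_t = H_F + tQ, t ∈ [0,1], is NOT filed as "∀t BEC_t" (each t > 0 is as hard as t
= 1; the t-independent relative content is
cruxes 2–3); finiteness of E₀^per (hard cores: low density); T > 0; anything Dirichlet beyond
BoundaryTransferWeak.

CHEAPEST FALSIFIER. (i) Dimension test, one kit job or one page: on the explicit 1-D Girardeau state
Ψ_N = ΠΠ|sin(π(x_k−x_j)/L)| (OneDimensionalHardCore, λ_max ~ √N) the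
1-D analogue of DressingBound holds verbatim, so the flat-mass of the dressed corrector MUST tend to
0 for every short-range dressing — compute
CV²_x(Ψ_N(x,Y)/Π_jφ(x−y_j)) for typical Y, N = 10…400 at fixed density: if it stays bounded, the
crux/glue pair is mis-typed. (ii) Lean, minutes (junk audit):
instantiate DressingBound at n = 0 (empty dressing, N = 1: it must read (1/(1+K))·[mass of the flat
event] ≤ n₀(Ψ) = L⁻³|∫Ψ|², true by the flatness
inequality itself) and JastrowAnchorBEC at N = 1 (constant state, n₀ = 1) and N = 0 (both sides 0) —
a refuter checks these first. (iii) Physics, one page: with LSSY's Dyson profile at b = Mρ^{-1/3},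
is ⟨W₃⟩ in the Jastrow measure F² itself ≤ C(ρab²)·aρN
(classical three-body integral ρ²∫∫q(r)q(r′)g₃)? If already the anchor violates it,
ParentEnergyProximity is dead as stated. (iv) Lookup: a printed
N-uniform lower bound n₀(Jastrow) ≥ (1−ρ∫(1−f))²N (Mayers' free-volume formula made rigorous) would
make the supports `known` — harmless to the route.

NUMBERS. ξ = (8πρa)^{-1/2}; LSSY2005_dysonProfile (proved): I = ∫(1−f²) ≤ 16πab², so
JastrowAnchorBEC gives n₀/N ≥ (1−16πρab²)² ≥ 1/4 iff b ≤ (32πρa)^{-1/2} =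
ξ/2. Physical Jastrow depletion ρ∫(1−f)² ≈ 4πρa²b (= O(√(ρa³)) at b ~ ξ, Bogoliubov order); the
anchor bound uses the cruder ρ∫(1−f) ≈ 2πρab².
Parent residual: Neumann/Kac well depth ε_b ≈ 6a/b³ (∫ε_b1_{B_b} ≈ 8πa), ⟨W₃⟩/N ~ ρa·O(ρab²); window
for crux 3: ρ^{-1/3} ≪ b ≪ ξ (b = Mρ^{-1/3},
errors a/b + M^{-3} + M²aρ^{1/3} + (ρa³)^{1/3}). Heuristic size of the flatness defect: Var_x log
g_Y ≈ πρα²/b with the Reatto–Chester coefficient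
α = mc/(2π²ħρ)-type (Griffin1993 (9.3)), i.e. O(a/b) in 3D; ∫dk/k-divergent in 1D. Items at open: 8
(3 cruxes, 1 target, 3 supports, 1 assembly).

DEFINITION REQUESTS. None filed: every item is typed over existing declarations of
Literature.MathematicalPhysics.QuantumManyBody.BoseGas (PeriodicTrialState,
periodicEnergy, periodicGroundStateEnergy, condensateOccupation, sideLength, cell, cellN, Config,
Space, IsPairProfile, pairFactor, jastrow,
jastrowNormR, profileDefect, kineticDensity, IsRepulsiveFiniteRange, HasGroundStateBEC,
BoseEinsteinCondensation; all `lean search`-verified,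
Sketch.lean rc 0). Lemma-level objects (parent profile, parent identity) are listed under Not
decomposed yet. Literature request filed by `lit read`:
acq-01260 (Mayers2001, cite-only).

Novelty: Searches (2026-08-15): `lit frontier AtomisticToContinuum --since 2020` (30 rows; BEC descendants
arXiv:2603.20776, arXiv:2510.20493, arXiv:2602.16566 —
all kinetic localisation); `lit bridges AtomisticToContinuum --cross any` (30 rows, no Bose-gas
bridge); `lit search --source crossref` ×7 ("Jastrow
wave function BEC condensate fraction ODLRO" → Mayers2001 doi:10.1103/physrevb.64.224521,
Girardeau1965 doi:10.1063/1.1704372; "Mayers phase coherence"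
→ doi:10.1103/physrevlett.92.135302, doi:10.1103/physrevb.74.014516; "Reatto Chester Jastrow" →
doi:10.1103/physrev.155.88, doi:10.1103/physreva.18.296;
"free volume condensate fraction hard sphere Penrose Onsager" → doi:10.1103/physrev.104.576;
"Jastrow trial state hard spheres GP" →
doi:10.1007/s00220-022-04547-y, doi:10.1017/fms.2021.66, doi:10.1007/s00205-024-02049-w; "parent
Hamiltonian exact Jastrow ground state bosons
three-body" → doi:10.1063/1.1666291, doi:10.21468/scipostphys.8.3.042); `lit search --hybrid` + `lit
vsearch` (held: Griffin1993 pp.182–188 READ,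
LSSY2005 pp.56–57 READ, Binder1992 p.259 READ); `lit galaxy search --star all` ×4 (substring: 0 hits
"Jastrow condensate fraction"; 3 queries
saturated, logged) + `--star panama --title-contains Bose "condensate fraction"` (8 books, none
new); OpenAlex/S2/arXiv HTTP 429 this pass; the
card's two novelty audits (CalogeroMarchioro1973, Sutherland1971, KKLZ1991, KhareRay1997,
Reatto1969, Ruelle1969) stand; in-tree: routes
BECJastrowKac / BECConditionalEntropy / BECPalmL  [refs: 10.1103/physrevb.64.224521, 10.1063/1.1704372, 10.1103/physrevlett.92.135302, 10.1103/physrevb.74.014516, 10.1103/physrev.155.88, 10.1103/physreva.18.296, 10.1103/physrev.104.576, 10.1007/s00220-022-04547-y, 10.1017/fms.2021.66, 10.1007/s00205-024-02049-w, 10.1063/1.1666291, 10.21468/scipostphys.8.3.042, 2603.20776, 2510.20493, 2602.16566, doi:10.1103/physrevb.64.224521, doi:10.1063/1.1704372, doi]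

Barriers (technique_class: parent-hamiltonian, jastrow-dressing, conditional-flatness): - technique_class: parent-hamiltonian, jastrow-dressing, conditional-flatness
- Literature.Barriers.AtomisticToContinuum.KineticGapLengthScales:
CorrectorFlatness/DressingBound/JastrowAnchorBEC are gap-free and N-uniform by construction (the
dressing bound is deterministic per environment, no L² factor, δ chosen after N so the Galilei-boost
lemma of KineticGapLengthScalesNarrow does not bite); CONCEDED for ParentEnergyProximity used alone:
small weighted Dirichlet energy + weighted Poincaré gives BEC only while L²ερ ≲ 1 (GP-type scales) —
it is filed as the quantitative anchor≈truth input of layer 2, not as a road to the thermodynamic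
limit; ParentHamiltonianBEC uses the fixed-N gap legitimately (δ after N).
- Literature.Barriers.AtomisticToContinuum.EnergyAsymptoticsWithoutCondensation: evaded — no item
infers condensation from energy asymptotics; energies enter only ParentEnergyProximity as relative
smallness of a Dirichlet form, and the 1-D Lieb–Liniger witness is consistent (in d = 1 energy
proximity can hold while CorrectorFlatness fails).
- Literature.Barriers.AtomisticToContinuum.BogoliubovPerturbationInfrared: it does not expand around
the Bogoliubov state; the bet is that the flatness defect is an equal-time static variance Var_x log
g_Y ≈ ρ∫_{r>b}δu² = O(ρα²/b), infrared-finite in d = 3 (the ω-integrals of the barrier never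
appear), with the d = 1 divergence as the built-in consistency check.
- Literature.Barriers.AtomisticToContinuum.PitaevskiiStringariOneDimension

History (route lifecycle, newest last):
- 2026-08-15T13:39:17Z · CLOSED retired — not-a-thesis: assembly does not conclude the sub-problem Statement (operator:999:1257524)

sub-problem: BoseEinsteinCondensation · status: closed(retired) · opened planner-plancard-AtomisticToContinuum-BoseEin-cd042693-0 2026-08-15T11:31:43Z · rev 0 · ledger route-AtomisticToContinuum-BECParentHamiltonian
GENERATED by the gate from the ledger (D-0016/17). Provers cite these decls: `theorem foo : Summit.AtomisticToContinuum.BoseEinsteinCondensation.Theses.BECParentHamiltonian.<Decl> := …` in Summits/AtomisticToContinuum/BoseEinsteinCondensation/Theorems/<Name>.lean.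
-/

namespace Summit.AtomisticToContinuum.BoseEinsteinCondensation.Theses.BECParentHamiltonian

open scoped BigOperators Topology Manifold Classical MeasureTheory ProbabilityTheory Matrix InnerProductSpace ComplexConjugate ContinuousMap
open Filter Set Function TopologicalSpace MeasureTheory

attribute [summit_statement] _root_.BoseEinsteinCondensation

/-- item stmt-AtomisticToContinuum-0826 · target · rank 0 · closed · moot by None · by planner
why it might fail: the textbook open problem (LSSY2005 §1.2, Ch. 5); for this route it fails iff CorrectorFlatness fails (DressingBound is deterministic).
sources: LiebSeiringerSolovejYngvason2005, Fournais2020, Junge2026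
[crux] PeriodicBEC: for every repulsive finite-range radial v there is ρ₀>0 such that for 0<ρ<ρ₀
there is c>0 with: for all large N there is δ>0 such that every PERIODIC trial state Ψ on the torus
of side L=(N/ρ)^{1/3} with periodicEnergy ≤ E₀^per(N,L)+δ has constant-mode occupation ⟨Ψ,n₀Ψ⟩ =
condensateOccupation N L Ψ ≥ cN. The open problem in the literature's own (translation-invariant)
setting; Fournais2020 Thm 1.2 gives it on scales L ≤ C(ρa³)^{-δ}(ρa)^{-1/2}, Junge2026 Cor. 6
(Neumann) up to a(ρa³)^{-3/4-η}. Sources: LiebSeiringerSolovejYngvason2005 Ch. 5; Fournais2020;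
Junge2026; ChongLiangNam2026. -/
@[route_item "route-AtomisticToContinuum-BECParentHamiltonian"]
def PeriodicBEC : Prop :=
  ∀ v : ℝ → ENNReal, Literature.MathematicalPhysics.QuantumManyBody.BoseGas.IsRepulsiveFiniteRange v → ∃ ρ₀ : ℝ, 0 < ρ₀ ∧ ∀ ρ : ℝ, 0 < ρ → ρ < ρ₀ → ∃ c : ℝ, 0 < c ∧ ∀ᶠ N : ℕ in Filter.atTop, ∃ δ : ENNReal, 0 < δ ∧ ∀ Ψ : Literature.MathematicalPhysics.QuantumManyBody.BoseGas.PeriodicTrialState N (Literature.MathematicalPhysics.QuantumManyBody.BoseGas.sideLength ρ N), Literature.MathematicalPhysics.QuantumManyBody.BoseGas.periodicEnergy v Ψ ≤ Literature.MathematicalPhysics.QuantumManyBody.BoseGas.periodicGroundStateEnergy v N (Literature.MathematicalPhysics.QuantumManyBody.BoseGas.sideLength ρ N) + δ → ENNReal.ofReal (c * N) ≤ Literature.MathematicalPhysics.QuantumManyBody.BoseGas.condensateOccupation N (Literature.MathematicalPhysics.QuantumManyBody.BoseGas.sideLength ρ N) Ψ.ψ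

/-- item stmt-AtomisticToContinuum-4278 · crux · rank 2 · closed · moot by None · by planner
why it might fail: Var_x log|g_Y| is set by the Reatto–Chester tail u≈α/r² beyond b: ≈ρα²/b in 3D (plausible) but log-divergent in 1D; mass ≥1−η for ALL δ-near-minimisers needs GS uniqueness+gap at fixed N (hard shells v=⊤·1_[R₁,R₂]); no tool controls g uniformly in N (card audit).
sources: ReattoChester1967 = doi:10.1103/physrev.155.88, Griffin1993 §9.1 (9.3) p.183 and p.188 (lit: book:griffin1993-excitations-bose-condensed-liquid), Mayers2001 = doi:10.1103/physrevb.64.224521, LiebSeiringerSolovejYngvason2005 Ch. 5, Literature.Barriers.AtomisticToContinuum.PitaevskiiStringariOneDimension, Literature.Barriers.AtomisticToContinuum.OneDimensionalHardCore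
[crux] for every repulsive finite-range v there is ρ₀ > 0 such that for 0 < ρ < ρ₀ there are a
positive C¹ pair profile φ of cut-off b, K ≥ 0, 0 ≤ η < 1 and J ≥ ∫(1−φ²) with ρJ(1+K) < 1 such that
for all large N = n+1 there is δ > 0 with: every δ-near-minimiser Ψ of the PERIODIC energy of v on
the torus of side L = (N/ρ)^{1/3} has an L²-flat dressed corrector, L³∫_cell|g_Y|² ≤ (1+K)|∫_cell
g_Y|² with g_Y(x) = Ψ(x,Y)/Π_jΦ(x−y_j), for a set of environments Y ∈ cell^n of |Ψ|²-mass ≥ 1−η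
(card crux (B) in state-level, N-uniform form; complex Ψ allowed: phase rigidity at fixed N is part
of the claim). [difficulty: open-problem] -/
@[route_item "route-AtomisticToContinuum-BECParentHamiltonian"]
def CorrectorFlatness : Prop :=
  ∀ v : ℝ → ENNReal, Literature.MathematicalPhysics.QuantumManyBody.BoseGas.IsRepulsiveFiniteRange v → ∃ ρ₀ : ℝ, 0 < ρ₀ ∧ ∀ ρ : ℝ, 0 < ρ → ρ < ρ₀ → ∃ (b K η J : ℝ) (φ : Literature.MathematicalPhysics.QuantumManyBody.BoseGas.Space → ℝ), Literature.MathematicalPhysics.QuantumManyBody.BoseGas.IsPairProfile b φ ∧ (∀ x, 0 < φ x) ∧ 0 < b ∧ 0 ≤ K ∧ 0 ≤ η ∧ η < 1 ∧ 0 ≤ J ∧ Literature.MathematicalPhysics.QuantumManyBody.BoseGas.profileDefect φ ≤ ENNReal.ofReal J ∧ ρ * J * (1 + K) < 1 ∧ ∀ᶠ n : ℕ in Filter.atTop, let L : ℝ := Literature.MathematicalPhysics.QuantumManyBody.BoseGas.sideLength ρ (n + 1); ∃ δ : ENNReal, 0 < δ ∧ ∀ Ψ : Literature.MathematicalPhysics.QuantumManyBody.BoseGas.PeriodicTrialState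 (n + 1) L, Literature.MathematicalPhysics.QuantumManyBody.BoseGas.periodicEnergy v Ψ ≤ Literature.MathematicalPhysics.QuantumManyBody.BoseGas.periodicGroundStateEnergy v (n + 1) L + δ → ENNReal.ofReal (1 - η) ≤ ∫⁻ Y in {Y : Literature.MathematicalPhysics.QuantumManyBody.BoseGas.Config n | Y ∈ Literature.MathematicalPhysics.QuantumManyBody.BoseGas.cellN n L ∧ ENNReal.ofReal (L ^ 3) * (∫⁻ x in Literature.MathematicalPhysics.QuantumManyBody.BoseGas.cell L, (‖Ψ.ψ (Matrix.vecCons x Y) / ∏ j, (Literature.MathematicalPhysics.QuantumManyBody.BoseGas.pairFactor L φ (x - Y j) : ℂ)‖₊ : ENNReal) ^ 2) ≤ ENNReal.ofReal (1 + K) * (‖∫ x in Literature.MathematicalPhysics.QuantumManyBody.BoseGas.cell L, Ψ.ψ (Matrix.vecCons x Y) / ∏ j, (Literature.MathematicalPhysics.QuantumManyBody.BoseGas.pairFactor L φ (x - Y j) : ℂ)‖₊ : ENNReal) ^ 2}, ∫⁻ x in Literature.MathematicalPhysics.QuantumManyBody.BoseGas.cell L, (‖Ψ.ψ (Matrix.vecCons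 x Y)‖₊ : ENNReal) ^ 2

/-- item stmt-AtomisticToContinuum-4279 · crux · rank 3 · closed · moot by None · by planner
why it might fail: needs ⟨W₃⟩_Ψ=⟨Σ_iΣ_{j≠k}∇logφ_ij·∇logφ_ik⟩ ≲ (ρab²)·aρN for near-minimisers — a three-body (second local-density moment) bound at scale b≫ρ^{-1/3} not in print for TL ground states; cores force θ-regularised φ with ∇logφ∼1/θ at contact.
sources: LiebSeiringerSolovejYngvason2005 Thm 2.2 and Lemma 2.5, Literature.MathematicalPhysics.QuantumManyBody.BoseGas.LSSY2005_upperBound_periodic, Literature.MathematicalPhysics.QuantumManyBody.BoseGas.LSSY2005_dysonProfile, CalogeroMarchioro1973 = doi:10.1063/1.1666291, BastiCenatiempoSchlein2021 = doi:10.1017/fms.2021.66, FournaisSolovej2020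
[crux] for every repulsive finite-range v and every ε > 0 there is ρ₀ > 0 such that for 0 < ρ < ρ₀
some positive C¹ pair profile φ (cut-off b; intended: the zero-scattering-length Dyson/Neumann
function of v at b = Mρ^{-1/3}, smoothed) makes every δ-near-minimiser Ψ of the periodic energy (N =
n+1 large, δ = δ(N) > 0, L = (N/ρ)^{1/3}) an ε-approximate ground state of the parent Hamiltonian of
F = Π_{i<j}Φ(x_i−x_j): ∫_{cell^N} F²|∇(Ψ/F)|² ≤ ερN. Route to it: the identity E_v[Fg] = ∫F²|∇g|² +
∫|Fg|²(ε_wΣw − W₃), the proved upper bound E₀ ≤ 4πaρN(1+o(1)) (LSSY2005_upperBound_periodic_holds),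
the free positive-definite pair count ⟨Σ_{i<j}w⟩ ≥ ½N(ρŵ(0) − w(0)), and a three-body bound on ⟨W₃⟩.
[difficulty: L] -/
@[route_item "route-AtomisticToContinuum-BECParentHamiltonian"]
def ParentEnergyProximity : Prop :=
  ∀ v : ℝ → ENNReal, Literature.MathematicalPhysics.QuantumManyBody.BoseGas.IsRepulsiveFiniteRange v → ∀ ε : ℝ, 0 < ε → ∃ ρ₀ : ℝ, 0 < ρ₀ ∧ ∀ ρ : ℝ, 0 < ρ → ρ < ρ₀ → ∃ (b : ℝ) (φ : Literature.MathematicalPhysics.QuantumManyBody.BoseGas.Space → ℝ), Literature.MathematicalPhysics.QuantumManyBody.BoseGas.IsPairProfile b φ ∧ (∀ x, 0 < φ x) ∧ 0 < b ∧ ∀ᶠ n : ℕ in Filter.atTop, let L : ℝ := Literature.MathematicalPhysics.QuantumManyBody.BoseGas.sideLength ρ (n + 1); ∃ δ : ENNReal, 0 < δ ∧ ∀ Ψ : Literature.MathematicalPhysics.QuantumManyBody.BoseGas.PeriodicTrialState (n + 1) L, Literature.MathematicalPhysics.QuantumManyBody.BoseGas.periodicEnergy v Ψ ≤ Literature.MathematicalPhysics.QuantumManyBody.BoseGas.periodicGroundStateEnergy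 v (n + 1) L + δ → ∫⁻ X in Literature.MathematicalPhysics.QuantumManyBody.BoseGas.cellN (n + 1) L, ENNReal.ofReal (Literature.MathematicalPhysics.QuantumManyBody.BoseGas.jastrow L φ Finset.univ X ^ 2) * Literature.MathematicalPhysics.QuantumManyBody.BoseGas.kineticDensity (fun Z => Ψ.ψ Z / (Literature.MathematicalPhysics.QuantumManyBody.BoseGas.jastrow L φ Finset.univ Z : ℂ)) X ≤ ENNReal.ofReal (ε * ρ * ((n : ℝ) + 1))

/-- item stmt-AtomisticToContinuum-0827 · crux · rank 4 · open · by planner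
why it might fail: PeriodicBEC(v) is ground-state-only (δ after N); the Dirichlet GS restricted to interior boxes is neither periodic nor of sharp N, so the hypothesis may never fire (transfer ≈ conjunct); BEC can be BC-sensitive (Robinson 1976).
sources: LiebSeiringerSolovejYngvason2005 Ch. 2 after (2.8), Basti2022 = arXiv:2203.01841, BoccatoSeiringer2023 = arXiv:2205.15284, Junge2026 = arXiv:2603.20776, Robinson1976 = doi:10.1007/bf01608554
[crux] BoundaryTransferWeak (mode-free boundary-condition transfer, per potential): for each
repulsive finite-range v, PeriodicBEC(v) implies ∃ρ₀>0 ∀ρ∈(0,ρ₀) HasGroundStateBEC v ρ (Dirichlet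
ground state, λ_max(γ) ≥ cN via condensateNumber). Not glue: near-minimiser slacks are O(N/L²) while
Dirichlet/periodic energies differ by a boundary term ≫ N/L², so no energy-comparison proof;
expected route: Neumann bracketing of interior sub-boxes (−Δ_Dir ≥ ⊕−Δ_Neu, v ≥ 0) + a mode-free
criterion (λ_max ≥ tr γ²/N). Only the ENERGY analogue is in print (LiebSeiringerSolovejYngvason2005
Ch. 2 after (2.8)). v ≡ 0: hypothesis and conclusion both true. -/
@[route_item "route-AtomisticToContinuum-BECParentHamiltonian"]
def BoundaryTransferWeak : Prop :=
  ∀ v : ℝ → ENNReal, Literature.MathematicalPhysics.QuantumManyBody.BoseGas.IsRepulsiveFiniteRange v → (∃ ρ₀ : ℝ, 0 < ρ₀ ∧ ∀ ρ : ℝ, 0 < ρ → ρ < ρ₀ → ∃ c : ℝ, 0 < c ∧ ∀ᶠ N : ℕ in Filter.atTop, ∃ δ : ENNReal, 0 < δ ∧ ∀ Ψ : Literature.MathematicalPhysics.QuantumManyBody.BoseGas.PeriodicTrialState N (Literature.MathematicalPhysics.QuantumManyBody.BoseGas.sideLength ρ N), Literature.MathematicalPhysics.QuantumManyBody.BoseGas.periodicEnergy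 v Ψ ≤ Literature.MathematicalPhysics.QuantumManyBody.BoseGas.periodicGroundStateEnergy v N (Literature.MathematicalPhysics.QuantumManyBody.BoseGas.sideLength ρ N) + δ → ENNReal.ofReal (c * N) ≤ Literature.MathematicalPhysics.QuantumManyBody.BoseGas.condensateOccupation N (Literature.MathematicalPhysics.QuantumManyBody.BoseGas.sideLength ρ N) Ψ.ψ) → ∃ ρ₀ : ℝ, 0 < ρ₀ ∧ ∀ ρ : ℝ, 0 < ρ → ρ < ρ₀ → Literature.MathematicalPhysics.QuantumManyBody.BoseGas.HasGroundStateBEC v ρ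

/-- item stmt-AtomisticToContinuum-4280 · support · rank 9 · closed · moot by None · by planner
sources: LiebSeiringerSolovejYngvason2005 Thm 2.2 proof (2.22)–(2.26), Mayers2001 = doi:10.1103/physrevb.64.224521, PenroseOnsager1956 §6, Griffin1993 p.188
[support] the anchor condenses, deterministically: for every pair profile φ of cut-off b (0 < 2b <
L), every N and I ≥ ∫(1−φ²) with (N−1)I < L³, the normalised Jastrow product Π_{i<j}Φ(x_i−x_j)/‖·‖
on the torus of side L has constant-mode occupation ≥ (1 − (N−1)I/L³)²·N. Proof: n₀/N = ∫
L³|m(Y)|²dY with m = cell-mean of Ψ(·,Y); Π_jΦ(x−y_j) ≥ 1 − Σ_j(1−Φ(x−y_j)) (LSSY (2.24)–(2.25))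
gives cell-mean ≥ 1 − (N−1)I/L³ while the cell-mean-square is ≤ 1. With LSSY2005_dysonProfile (I ≤
16πab²): n₀/N ≥ 1/4 for b ≤ ξ/2, ξ = (8πρa)^{-1/2}. [difficulty: provable-now] -/
@[route_item "route-AtomisticToContinuum-BECParentHamiltonian"]
def JastrowAnchorBEC : Prop :=
  ∀ (N : ℕ) (L b I : ℝ) (φ : Literature.MathematicalPhysics.QuantumManyBody.BoseGas.Space → ℝ), Literature.MathematicalPhysics.QuantumManyBody.BoseGas.IsPairProfile b φ → 0 < L → 0 < b → 2 * b < L → 0 ≤ I → Literature.MathematicalPhysics.QuantumManyBody.BoseGas.profileDefect φ ≤ ENNReal.ofReal I → ((N : ℝ) - 1) * I < L ^ 3 → ENNReal.ofReal ((1 - ((N : ℝ) - 1) * I / L ^ 3) ^ 2 * N) ≤ Literature.MathematicalPhysics.QuantumManyBody.BoseGas.condensateOccupation N L (fun X => ((Literature.MathematicalPhysics.QuantumManyBody.BoseGas.jastrow L φ Finset.univ X / Real.sqrt (Literature.MathematicalPhysics.QuantumManyBody.BoseGas.jastrowNormR L φ (Finset.univ : Finset (Fin N))) : ℝ) : ℂ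))

/-- item stmt-AtomisticToContinuum-4281 · support · rank 9 · closed · moot by None · by planner
sources: Mayers2001 = doi:10.1103/physrevb.64.224521, LiebSeiringerSolovejYngvason2005 (2.24)–(2.25)
[support] deterministic dressing transfer at fixed N = n+1, L, positive profile φ (0 < 2b < L), K, J
≥ ∫(1−φ²) with nJ(1+K) < L³: for every periodic trial state Ψ, (n+1)(1−√(nJ(1+K)/L³))²/(1+K) ×
[|Ψ|²-mass of the environments Y ∈ cell^n whose dressed corrector g_Y = Ψ(·,Y)/Π_jΦ(·−y_j) satisfies
L³∫_cell|g_Y|² ≤ (1+K)|∫_cell g_Y|²] ≤ n₀(Ψ). Proof: |∫Dg| ≥ |∫g| − √(∫(1−D))·√(∫|g|²), ∫_cell(1−D)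
≤ nJ, and ∫|Dg|² ≤ ∫|g|²; then n₀ = (n+1)∫L³|m|² ≥ c₀(n+1)∫_flat L³ s. [difficulty: provable-now] -/
@[route_item "route-AtomisticToContinuum-BECParentHamiltonian"]
def DressingBound : Prop :=
  ∀ (n : ℕ) (L b K J : ℝ) (φ : Literature.MathematicalPhysics.QuantumManyBody.BoseGas.Space → ℝ) (Ψ : Literature.MathematicalPhysics.QuantumManyBody.BoseGas.PeriodicTrialState (n + 1) L), Literature.MathematicalPhysics.QuantumManyBody.BoseGas.IsPairProfile b φ → (∀ x, 0 < φ x) → 0 < L → 0 < b → 2 * b < L → 0 ≤ K → 0 ≤ J → Literature.MathematicalPhysics.QuantumManyBody.BoseGas.profileDefect φ ≤ ENNReal.ofReal J → (n : ℝ) * J * (1 + K) < L ^ 3 → ENNReal.ofReal (((n : ℝ) + 1) * (1 - Real.sqrt ((n : ℝ) * J * (1 + K) / L ^ 3)) ^ 2 / (1 + K)) * (∫⁻ Y in {Y : Literature.MathematicalPhysics.QuantumManyBody.BoseGas.Config n | Y ∈ Literature.MathematicalPhysics.QuantumManyBody.BoseGas.cellN n L ∧ ENNReal.ofReal (L ^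 3) * (∫⁻ x in Literature.MathematicalPhysics.QuantumManyBody.BoseGas.cell L, (‖Ψ.ψ (Matrix.vecCons x Y) / ∏ j, (Literature.MathematicalPhysics.QuantumManyBody.BoseGas.pairFactor L φ (x - Y j) : ℂ)‖₊ : ENNReal) ^ 2) ≤ ENNReal.ofReal (1 + K) * (‖∫ x in Literature.MathematicalPhysics.QuantumManyBody.BoseGas.cell L, Ψ.ψ (Matrix.vecCons x Y) / ∏ j, (Literature.MathematicalPhysics.QuantumManyBody.BoseGas.pairFactor L φ (x - Y j) : ℂ)‖₊ : ENNReal) ^ 2}, ∫⁻ x in Literature.MathematicalPhysics.QuantumManyBody.BoseGas.cell L, (‖Ψ.ψ (Matrix.vecCons x Y)‖₊ : ENNReal) ^ 2) ≤ Literature.MathematicalPhysics.QuantumManyBody.BoseGas.condensateOccupation (n + 1) L Ψ.ψ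

/-- item stmt-AtomisticToContinuum-4282 · support · rank 9 · closed · moot by None · by planner
sources: CalogeroMarchioro1973 = doi:10.1063/1.1666291, LiebSeiringerSolovejYngvason2005 Lemma 4.1 (in tree: LSSY2005_lemma41_periodic, neumannPoincare_boxN), ReedSimonIV1978 XIII.12
[support] the card's theorem-candidate (A) in near-minimiser form: for every positive pair profile φ
(cut-off b), J ≥ ∫(1−φ²) and density with 2ρJ ≤ 1, for all large N = n+1 there is δ > 0 such that
every periodic trial state Ψ whose parent form ∫_{cell^N}F²|∇(Ψ/F)|² is ≤ δ (i.e. every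
δ-near-minimiser of the parent Hamiltonian H_F = −Δ + ΔF/F ≥ 0, whose ground state is the Jastrow
state F) has constant-mode occupation ≥ N/8 on the torus of side (N/ρ)^{1/3}. Proof: weighted
Poincaré on the torus at fixed N (F² ∈ [θ^{N(N−1)},1]) ⇒ Ψ ≈ cF in L²; √(n₀/N) is 1-Lipschitz in Ψ;
JastrowAnchorBEC. [difficulty: M] -/
@[route_item "route-AtomisticToContinuum-BECParentHamiltonian"]
def ParentHamiltonianBEC : Prop :=
  ∀ (b J : ℝ) (φ : Literature.MathematicalPhysics.QuantumManyBody.BoseGas.Space → ℝ), Literature.MathematicalPhysics.QuantumManyBody.BoseGas.IsPairProfile b φ → (∀ x, 0 < φ x) → 0 < b → 0 ≤ J → Literature.MathematicalPhysics.QuantumManyBody.BoseGas.profileDefect φ ≤ ENNReal.ofReal J → ∀ ρ : ℝ, 0 < ρ → 2 * ρ * J ≤ 1 → ∀ᶠ n : ℕ in Filter.atTop, let L : ℝ := Literature.MathematicalPhysics.QuantumManyBody.BoseGas.sideLength ρ (n + 1); ∃ δ : ENNReal, 0 < δ ∧ ∀ Ψ : Literature.MathematicalPhysics.QuantumManyBody.BoseGas.PeriodicTrialState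 (n + 1) L, (∫⁻ X in Literature.MathematicalPhysics.QuantumManyBody.BoseGas.cellN (n + 1) L, ENNReal.ofReal (Literature.MathematicalPhysics.QuantumManyBody.BoseGas.jastrow L φ Finset.univ X ^ 2) * Literature.MathematicalPhysics.QuantumManyBody.BoseGas.kineticDensity (fun Z => Ψ.ψ Z / (Literature.MathematicalPhysics.QuantumManyBody.BoseGas.jastrow L φ Finset.univ Z : ℂ)) X) ≤ δ → ENNReal.ofReal (((n : ℝ) + 1) / 8) ≤ Literature.MathematicalPhysics.QuantumManyBody.BoseGas.condensateOccupation (n + 1) L Ψ.ψ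

/-- item stmt-AtomisticToContinuum-4283 · assembly · rank 1 · closed · moot by None · by planner
sources: LiebSeiringerSolovejYngvason2005
[assembly] CorrectorFlatness → DressingBound → BoundaryTransferWeak → BoseEinsteinCondensation. -/
@[route_item "route-AtomisticToContinuum-BECParentHamiltonian"]
def Assembly : Prop :=
  CorrectorFlatness → DressingBound → BoundaryTransferWeak → Literature.MathematicalPhysics.QuantumManyBody.BoseGas.BoseEinsteinCondensation

end Summit.AtomisticToContinuum.BoseEinsteinCondensation.Theses.BECParentHamiltonian
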